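import Literature.Probability.LatticeModels.LebowitzCoexistence
import HarnessLib

/-!
# Bodineau's theorem (`bodineau_translationInvariant`): its one remaining input — the free and
# plus nearest-neighbour energies agree above `β_c` in `d ≥ 3` — as a named fact

Topic `Probability/LatticeModels`, namespace `Literature.Probability.LatticeModels`. Librarian fact
decomposition (`fact-decompose`, human 2026-08-16) of the budget-capped named fact
`bodineau_translationInvariant` (`GibbsStates.lean`; T. Bodineau, *Translation invariant Gibbs
states for the Ising model*, Probab. Theory Related Fields 135 (2006) 153–168: for `d ≥ 3` and
`β > β_c(d)` every translation invariant `μ ∈ 𝒢(β, 0)` is a mixture of `μ⁺` and `μ⁻`).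

State of the tree: `LebowitzCoexistence.lean` PROVES Lebowitz' theorem (J. Stat. Phys. 16 (1977),
Thms. 2–3 and Remark (iii)) in the form
`bodineau_translationInvariant_of_nn_freeCorr_eq_plusCorr`: at `(d, β)` the named fact follows from
the identity `⟨σ_0σ_{eᵢ}⟩^∅_{β,0} = ⟨σ_0σ_{eᵢ}⟩⁺_{β,0}` for every direction `i` (equality of the free
and plus nearest-neighbour two-point functions, i.e. differentiability of the pressure in `β`).
That identity is the one deep input of Bodineau's route (§2.3: Thm. 2.1, uniqueness of the
infinite-volume FK–Ising measure for `β > β_c` when `d ≥ 3`, read in spin language through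
Edwards–Sokal; proved for every `β` and every amenable transitive graph by Raoufi 2020, Prop. 1). This file names
it, in Raoufi's printed generality specialised to `ℤ^d`:

* `Raoufi2020_nn_freeCorr_eq_plusCorr` — Raoufi 2020, Prop. 1 on `ℤ^d`: for `d ≥ 1`, `β ≥ 0` and
  every `i`, `freeCorr d β 0 {0, eᵢ} = plusCorr d β 0 {0, eᵢ}`;
* `bodineau_translationInvariant_holds_of` — the assembly, `bodineau_translationInvariant_of_nn_freeCorr_eq_plusCorr`.

The child does not restate the parent (a two-point-function identity between the free and plus
states vs. the structure of the simplex of translation invariant Gibbs states); the alternative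
input `bodineau_translationInvariant_of_leftContinuous_magnetization`
(`LebowitzMagnetizationCriterion.lean`: left-continuity of `β ↦ m*(β)` above `β_c`) is implied by
it through Lebowitz' Remark (iii) and is not recorded separately.

## References

* T. Bodineau, Probab. Theory Related Fields 135 (2006) 153–168, Thm. 2.1 and §2.3 (p. 156)
  [Bodineau2006].
* A. Raoufi, *Translation-invariant Gibbs states of the Ising model: general setting*, Ann.
  Probab. 48 (2020) 760–777 (the identity `⟨σ_xσ_y⟩⁺_β = ⟨σ_xσ_y⟩^f_β` for neighbours, all `β`)
  [Raoufi2020].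
* J. L. Lebowitz, J. Stat. Phys. 16 (1977) 463–476, Thms. 2–3, Remark (iii) p. 472 [Lebowitz1977].
* G. Grimmett, *The Random-Cluster Model* (2006), Thm. 4.63 / Thm. 5.16 (free = wired iff equal
  edge densities).
-/

noncomputable section

open MeasureTheory Filter Topology Finset
open scoped ENNReal

namespace Literature.Probability.LatticeModels

variable {d : ℕ} {β : ℝ}

/-- **Raoufi 2020, Proposition 1, for the nearest-neighbour Ising model on `ℤ^d`: the free and
plus states have the same nearest-neighbour two-point function, at every `β`.** Printed: "Let `G`
be an amenable transitive graph endowed with coupling constants satisfying (C1–C4) [ferromagnetic,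
automorphism invariant, irreducible, locally finite]. For any `β ∈ [0, ∞]` and `x, y ∈ G` such
that `J_{xy} > 0`, `⟨σ_xσ_y⟩⁺_{G,β} = ⟨σ_xσ_y⟩⁰_{G,β}`" (`⟨·⟩⁰` = the free state). Rendered for
`G = ℤ^d`, `d ≥ 1` (amenable, transitive; nearest-neighbour couplings satisfy (C1–C4)), finite
`β ≥ 0`, zero field, and the neighbouring pairs `{0, eᵢ}` at the origin (all neighbouring pairs
follow by translation invariance; this instance is what Lebowitz' criterion consumes):
`freeCorr d β 0 {0, eᵢ} = plusCorr d β 0 {0, eᵢ}` (`IsingThermodynamics.lean`; both box limits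
exist for `β ≥ 0`, `hasBoxLimit_isingCorr_free/plus`). Equivalently (Lebowitz 1977, Thm. 2;
Raoufi, Cor. 2) the pressure is differentiable in `β`. Earlier, for `d ≥ 3` and `β > β_c(d)`:
Bodineau 2006, Thm. 2.1 with §2.3 (uniqueness of the infinite-volume FK–Ising measure, read in
spin language through Edwards–Sokal). Raoufi's proof: random currents (§2, Thms. 2–3: the number
of infinite clusters of the sourceless double current and their ends on amenable graphs) and a
Burton–Keane type argument (§3). This is the hypothesis `hfp` of the tree's PROVED reduction
`bodineau_translationInvariant_of_nn_freeCorr_eq_plusCorr`, in printed generality.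
[cite: Raoufi2020, Prop. 1] [cite: Bodineau2006, Thm. 2.1 and §2.3 (p. 156)] -/
def Raoufi2020_nn_freeCorr_eq_plusCorr : Prop :=
  ∀ (d : ℕ) (β : ℝ), 1 ≤ d → 0 ≤ β →
    ∀ i : Fin d, freeCorr d β 0 {0, Pi.single i 1} = plusCorr d β 0 {0, Pi.single i 1}

/-- **Bodineau's theorem (`bodineau_translationInvariant`) from Raoufi's Proposition 1** — the
fact split: Lebowitz 1977, Thms. 2–3 and Remark (iii) (proved in the tree as
`bodineau_translationInvariant_of_nn_freeCorr_eq_plusCorr`) applied to the child at `(d, β)`;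
`β ≥ 0` because `β > β_c(d) > 0` for `d ≥ 2` (`criticalBeta_pos_holds`, Peierls). This is also the
route of Raoufi 2020, Thm. 1 (via Lebowitz) and of Bodineau 2006, §2.3.
[cite: Raoufi2020, Thm. 1 (proof: Prop. 1 and Lebowitz 1977)] [cite: Bodineau2006, §2.3 (p. 156)] [cite: Lebowitz1977, §3, Thm. 3 and Remark (iii), p. 472] -/
theorem bodineau_translationInvariant_holds_of (h : Raoufi2020_nn_freeCorr_eq_plusCorr) :
    bodineau_translationInvariant (d := d) (β := β) := by
  intro hd hβc μ hμ hμT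
  have hd2 : 2 ≤ d := le_trans (by norm_num) hd
  have hβ : 0 ≤ β := ((criticalBeta_pos_holds hd2).trans hβc).le
  exact bodineau_translationInvariant_of_nn_freeCorr_eq_plusCorr
    (h d β (le_trans (by norm_num) hd) hβ) hd hβc μ hμ hμT

end Literature.Probability.LatticeModels

end
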